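import Mathlib
import Literature.NumberTheory.DiophantineGeometry.AbcWave0
import Literature.NumberTheory.DiophantineGeometry.PastenSubexpTheorem14
import Summits.ABC.ABC.Theorems.ThreeSlotZooSquareSquare
import Summits.ABC.ABC.Theorems.SolvedZooL3Consumer

/-!
# Family L2 of the three-prime zoo is the singleton `(1, 57121, 57122)` modulo Cohn 1996 (odd exponent) and Ljunggren 1942

Consumer file for `SolvedZooABC` (stmt-ABC-24025, `route-ABC-ThreeSlotCyclotomicDescent`),
family (ii) of the typed statement, in both orientations:
`a = 1, b = p^(2u), c = 2 · r^z` (`p, r` prime, `1 ≤ u`, `4 ≤ z`, `z` even), i.e. the negative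
Pell equation `X² + 1 = 2 · Y²` with `X = p^u` and `Y = r^(z/2)` a perfect power (`z/2 ≥ 2`).

WHICH CONJUNCT, MODULO WHICH FACTS. This file discharges the family-(ii) (= L2) disjunct of
stmt-ABC-24025 — and nothing else — MODULO TWO PRINTED THEOREMS NOT (YET) PROVED IN THE TREE,
entering as explicit hypotheses stated INLINE (no `def`, no new named fact in this file):

* `hOdd` — J. H. E. Cohn, "Perfect Pell powers", Glasgow Math. J. 38 (1996) 19–20, LEMMA, in its
  ODD-EXPONENT half: `y² + 1 = 2 · z^(2K+1)` with `K ≥ 1`, `z > 0` forces `z = 1`. Its Prop text is,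
  verbatim, the signature keyed to the prover seats abc-inputs-pr-2 and pr-3 (KEY COHN-ODD-LEAD:
  `theorem cohn1996_lemma_odd {y z : ℤ} {K : ℕ} (hK : 1 ≤ K) (hz : 0 < z)
  (h : y ^ 2 + 1 = 2 * z ^ (2 * K + 1)) : z = 1`); when that theorem lands the hypothesis is
  discharged BY NAME (follow-up), making this half unconditional.
* `hQuartic` — W. Ljunggren 1942 (Avh. Norske Vid. Akad. Oslo I 1942 no. 5): `x² + 1 = 2 · t⁴` has
  only `x ∈ {1, 239}`, i.e. `t = 1 ∨ t = 13` (secondary: Guy, *Unsolved Problems in Number Theory*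
  (1994) D6 pp. 162–163; Cohen, *Number Theory I*, Thm 6.8.6 p. 481). Its Prop text is, verbatim,
  the statement the typer seat abc-harv-typ-1 (KEY ZOO-FACTS) files as the Literature named fact
  `Literature.NumberTheory.DiophantineGeometry.ljunggren1942_sqPlusOneEqTwiceFourth`; this quartic
  is the deep input (XL; primary not held, acq-13752) and the L2 triple `239² + 1 = 2·13⁴` lives in it.

Reduction (desk ruling 2026-08-28T01:30:28Z; the Pethő/Cohn "perfect Pell powers" form): write
`z = 2k`, `k ≥ 2`, `k = 2^e · m` with `m` odd. If `m ≥ 3` then `X² + 1 = 2 · (r^(2^(e+1)))^m` and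
`hOdd` gives `r^(2^(e+1)) = 1`, absurd. So `m = 1`, `e ≥ 1`, `z = 4 · 2^(e−1)` and
`X² + 1 = 2 · (r^(2^(e−1)))⁴`; `hQuartic` gives `r^(2^(e−1)) = 13`, so `r = 13`, `z = 4`, `X = 239`,
`(p, u) = (239, 1)`: the triple is `(1, 57121, 57122)`, `rad = 2 · 13 · 239 = 6214`, `c/rad ≈ 9.19`.

Content: `l2_params` (parameters forced), `l2_triple_eq` / `l2_triple_eq_swap`, `rad_ge_6214`,
`solvedZoo_L2_of hOdd hQuartic` (C = 10).

HONESTY: PROVED-MOD-FACTS, not proved — stmt-ABC-24025 stays OPEN; this is the L2 conjunct modulo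
{Cohn 1996 odd half (being proved by abc-inputs-pr-2 and pr-3), Ljunggren 1942 (unproved, XL)}.
INPUTS→UNCONDITIONAL (D-0154 (2)) bookkeeping: not abc, not the cell B₃, abc moved by 0;
typed ≠ proved.
-/

namespace Summit.ABC.ABC.Theorems.SolvedZooL2Consumer

open Literature.NumberTheory.DiophantineGeometry (IsABCTriple rad rad_def rad_swap)
open UniqueFactorizationMonoid (radical)
open Summit.ABC.ABC.Theorems.ThreeSlotZooSquareSquare (mul_dvd_radical)
open Summit.ABC.ABC.Theorems.SolvedZooL3Consumer (lt_mul_rpow_of_lt_mul)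

/-- A prime power `r ^ n` with `n ≠ 0` is not `1`. [folklore] -/
theorem prime_pow_ne_one {r n : ℕ} (hr : r.Prime) (hn : n ≠ 0) : r ^ n ≠ 1 := by
  intro h
  rcases Nat.pow_eq_one.mp h with h1 | h1
  · exact hr.one_lt.ne' h1
  · exact hn h1

/-- **Parameters of family (ii) modulo Cohn 1996 (odd exponent) and Ljunggren 1942.** If
`p ^ (2u) + 1 = 2 · r ^ z` with `p, r` prime, `1 ≤ u`, `4 ≤ z`, `z` even, then — assuming `hOdd`
(Cohn 1996, Lemma, odd-exponent half; inline, to be discharged by the theorem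
`cohn1996_lemma_odd` of abc-inputs-pr-2 and pr-3) and `hQuartic` (Ljunggren 1942; inline, to become
`Literature.NumberTheory.DiophantineGeometry.ljunggren1942_sqPlusOneEqTwiceFourth`) —
necessarily `p = 239`, `u = 1`, `r = 13`, `z = 4` (`239² + 1 = 2 · 13⁴`). -/
theorem l2_params
    (hOdd : ∀ {y z : ℤ} {K : ℕ}, 1 ≤ K → 0 < z → y ^ 2 + 1 = 2 * z ^ (2 * K + 1) → z = 1)
    (hQuartic : ∀ x t : ℕ, x ^ 2 + 1 = 2 * t ^ 4 → t = 1 ∨ t = 13)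
    {u p r z : ℕ} (hp : p.Prime) (hr : r.Prime) (hu : 1 ≤ u) (hz4 : 4 ≤ z) (hze : Even z)
    (h : p ^ (2 * u) + 1 = 2 * r ^ z) :
    p = 239 ∧ u = 1 ∧ r = 13 ∧ z = 4 := by
  obtain ⟨k, hk⟩ := hze
  have hk0 : k ≠ 0 := by omega
  obtain ⟨e, m, hm, hkm⟩ := Nat.exists_eq_two_pow_mul_odd hk0
  rcases Nat.lt_or_ge 1 m with h1m | hm1
  · -- `m` odd and `> 1`: the odd-exponent case, killed by `hOdd`
    obtain ⟨K, rfl⟩ := hm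
    have hK : 1 ≤ K := by omega
    have hzfac : z = 2 ^ (e + 1) * (2 * K + 1) := by rw [hk, hkm]; ring
    have hN : (p ^ u) ^ 2 + 1 = 2 * (r ^ 2 ^ (e + 1)) ^ (2 * K + 1) := by
      rw [← pow_mul, ← pow_mul, ← hzfac, mul_comm u 2]
      exact h
    have hZ : ((p ^ u : ℕ) : ℤ) ^ 2 + 1 = 2 * ((r ^ 2 ^ (e + 1) : ℕ) : ℤ) ^ (2 * K + 1) := by
      exact_mod_cast hN
    have hpos : (0 : ℤ) < ((r ^ 2 ^ (e + 1) : ℕ) : ℤ) := by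
      exact_mod_cast pow_pos hr.pos _
    have h1 : ((r ^ 2 ^ (e + 1) : ℕ) : ℤ) = 1 := hOdd hK hpos hZ
    have h1' : r ^ 2 ^ (e + 1) = 1 := by exact_mod_cast h1
    exact absurd h1' (prime_pow_ne_one hr (pow_ne_zero _ two_ne_zero))
  · -- `m = 1`: `k = 2^e` with `e ≥ 1`, the quartic case
    have hm1' : m = 1 := by
      obtain ⟨K, rfl⟩ := hm
      omega
    subst hm1'
    rw [mul_one] at hkm
    have he : e ≠ 0 := by
      rintro rfl
      rw [pow_zero] at hkm
      omega
    obtain ⟨f, rfl⟩ : ∃ f, e = f + 1 := ⟨e - 1, by omega⟩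
    have hzw : z = 4 * 2 ^ f := by rw [hk, hkm]; ring
    have hN : (p ^ u) ^ 2 + 1 = 2 * (r ^ 2 ^ f) ^ 4 := by
      rw [← pow_mul, ← pow_mul, mul_comm u 2, mul_comm (2 ^ f) 4, ← hzw]
      exact h
    rcases hQuartic (p ^ u) (r ^ 2 ^ f) hN with h1 | h13
    · exact absurd h1 (prime_pow_ne_one hr (pow_ne_zero _ two_ne_zero))
    · obtain ⟨rfl, hf⟩ := (Nat.Prime.pow_eq_iff (by norm_num : Nat.Prime 13)).mp h13
      have hf0 : f = 0 := by
        rcases Nat.pow_eq_one.mp hf with h2 | h2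
        · norm_num at h2
        · exact h2
      subst hf0
      have hX : (p ^ u) ^ 2 = 239 ^ 2 := by
        norm_num at hN
        omega
      have hX' : p ^ u = 239 := Nat.pow_left_injective (by norm_num) hX
      obtain ⟨rfl, rfl⟩ := (Nat.Prime.pow_eq_iff (by norm_num : Nat.Prime 239)).mp hX'
      refine ⟨rfl, rfl, rfl, ?_⟩
      rw [hzw]
      norm_num

/-- **Family (ii) is the single triple `(1, 57121, 57122)`** modulo Cohn 1996 (odd exponent,
`hOdd`, inline) and Ljunggren 1942 (`hQuartic`, inline). -/
theorem l2_triple_eq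
    (hOdd : ∀ {y z : ℤ} {K : ℕ}, 1 ≤ K → 0 < z → y ^ 2 + 1 = 2 * z ^ (2 * K + 1) → z = 1)
    (hQuartic : ∀ x t : ℕ, x ^ 2 + 1 = 2 * t ^ 4 → t = 1 ∨ t = 13)
    {a b c : ℕ} (ht : IsABCTriple a b c)
    (hfam : ∃ u p r z : ℕ, p.Prime ∧ r.Prime ∧ 1 ≤ u ∧ 4 ≤ z ∧ Even z ∧ a = 1 ∧
      b = p ^ (2 * u) ∧ c = 2 * r ^ z) :
    a = 1 ∧ b = 57121 ∧ c = 57122 := by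
  obtain ⟨u, p, r, z, hp, hr, hu, hz4, hze, rfl, rfl, rfl⟩ := hfam
  have h : p ^ (2 * u) + 1 = 2 * r ^ z := by have := ht.2.2.1; omega
  obtain ⟨rfl, rfl, rfl, rfl⟩ := l2_params hOdd hQuartic hp hr hu hz4 hze h
  norm_num

/-- The swapped orientation: family (ii) with `b = 1` is the single triple `(57121, 1, 57122)`
modulo Cohn 1996 (odd exponent, `hOdd`, inline) and Ljunggren 1942 (`hQuartic`, inline). -/
theorem l2_triple_eq_swap
    (hOdd : ∀ {y z : ℤ} {K : ℕ}, 1 ≤ K → 0 < z → y ^ 2 + 1 = 2 * z ^ (2 * K + 1) → z = 1)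
    (hQuartic : ∀ x t : ℕ, x ^ 2 + 1 = 2 * t ^ 4 → t = 1 ∨ t = 13)
    {a b c : ℕ} (ht : IsABCTriple a b c)
    (hfam : ∃ u p r z : ℕ, p.Prime ∧ r.Prime ∧ 1 ≤ u ∧ 4 ≤ z ∧ Even z ∧ b = 1 ∧
      a = p ^ (2 * u) ∧ c = 2 * r ^ z) :
    a = 57121 ∧ b = 1 ∧ c = 57122 := by
  obtain ⟨u, p, r, z, hp, hr, hu, hz4, hze, rfl, rfl, rfl⟩ := hfam
  have h : p ^ (2 * u) + 1 = 2 * r ^ z := by have := ht.2.2.1; omega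
  obtain ⟨rfl, rfl, rfl, rfl⟩ := l2_params hOdd hQuartic hp hr hu hz4 hze h
  norm_num

/-- `rad(1 · 57121 · 57122) ≥ 6214 = 2 · 13 · 239` (the three primes of `239² · 2 · 13⁴` divide
the radical; in fact `rad = 6214`, but the lower bound is all that is used). [folklore] -/
theorem rad_ge_6214 : 6214 ≤ rad 1 57121 57122 := by
  rw [rad_def]
  have h13 : Nat.Prime 13 := by norm_num
  have h239 : Nat.Prime 239 := by norm_num
  have h : 2 * 13 * 239 ∣ radical (1 * 57121 * 57122 : ℕ) :=
    mul_dvd_radical Nat.prime_two h13 h239 (by norm_num) (by norm_num) (by norm_num)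
      (by norm_num) (by norm_num) (by norm_num) (by norm_num)
  exact Nat.le_of_dvd (Nat.radical_pos _) h

/-- **`SolvedZooABC` restricted to family (ii) = L2 (both orientations), modulo Cohn 1996 (odd
exponent) and Ljunggren 1942.** For every `ε > 0` the constant `C = 10` works: the family is
`{(1, 57121, 57122)}` ∪ swap and `57122 < 10 · 6214 ≤ 10 · rad ≤ 10 · rad^(1+ε)` (so the L2
disjunct is genuinely needed at `C = 5`). Hypotheses INLINE: `hOdd` = Cohn 1996 Lemma, odd half
(to be discharged by `cohn1996_lemma_odd`, abc-inputs-pr-2 and pr-3), `hQuartic` = Ljunggren 1942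
(verbatim the Prop the typer files as `ljunggren1942_sqPlusOneEqTwiceFourth`; unproved, XL).
PROVED-MOD-FACTS ≠ proved; this is the L2 conjunct of stmt-ABC-24025 only. -/
theorem solvedZoo_L2_of
    (hOdd : ∀ {y z : ℤ} {K : ℕ}, 1 ≤ K → 0 < z → y ^ 2 + 1 = 2 * z ^ (2 * K + 1) → z = 1)
    (hQuartic : ∀ x t : ℕ, x ^ 2 + 1 = 2 * t ^ 4 → t = 1 ∨ t = 13) :
    ∀ ε : ℝ, 0 < ε → ∃ C : ℝ, 0 < C ∧ ∀ a b c : ℕ, IsABCTriple a b c →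
      ((∃ u p r z : ℕ, p.Prime ∧ r.Prime ∧ 1 ≤ u ∧ 4 ≤ z ∧ Even z ∧ a = 1 ∧
          b = p ^ (2 * u) ∧ c = 2 * r ^ z) ∨
       (∃ u p r z : ℕ, p.Prime ∧ r.Prime ∧ 1 ≤ u ∧ 4 ≤ z ∧ Even z ∧ b = 1 ∧
          a = p ^ (2 * u) ∧ c = 2 * r ^ z)) →
      (c : ℝ) < C * ((rad a b c : ℕ) : ℝ) ^ (1 + ε) := by
  intro ε hε
  refine ⟨10, by norm_num, ?_⟩
  rintro a b c ht (hfam | hfam)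
  · obtain ⟨rfl, rfl, rfl⟩ := l2_triple_eq hOdd hQuartic ht hfam
    have h6214 : (6214 : ℝ) ≤ (rad 1 57121 57122 : ℕ) := by exact_mod_cast rad_ge_6214
    exact lt_mul_rpow_of_lt_mul (le_trans (by norm_num) rad_ge_6214) (by norm_num)
      (by push_cast; linarith) hε
  · obtain ⟨rfl, rfl, rfl⟩ := l2_triple_eq_swap hOdd hQuartic ht hfam
    have hsw : rad 57121 1 57122 = rad 1 57121 57122 := rad_swap 1 57121 57122
    have h6214 : (6214 : ℝ) ≤ (rad 57121 1 57122 : ℕ) := by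
      rw [hsw]; exact_mod_cast rad_ge_6214
    exact lt_mul_rpow_of_lt_mul (le_trans (by norm_num) (hsw ▸ rad_ge_6214)) (by norm_num)
      (by push_cast; linarith) hε

end Summit.ABC.ABC.Theorems.SolvedZooL2Consumer
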